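import Mathlib
import HarnessLib
import Literature.MathematicalPhysics.QuantumFieldTheory.ConstructiveQFTWave0
import Summits.Ventures.LatticeQCDFlow.Scaling.Conjectures

/-!
# LatticeQCDFlow / Scaling — (U′) / clustering floor: the diagonal-plane instances `i = j` are FALSE

HONEST FRAMING: exact (Metropolis-corrected) sampling algorithms for lattice gauge theory; figures of merit are
autocorrelation/cost numbers at stated couplings and volumes; no continuum-physics claim.

Venture `LatticeQCDFlow` (cell pub-lqcd), topic `Scaling`, FANOUT row 30 (lean-1) — OUR WORK; negative edge (class
MISSTATED: the items are meant for a genuine plaquette plane `i ≠ j`, cf. their docstrings) of the conjecture items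
`Conjectures.CrossCutCorrelatorFloor d N G ρ β R i j a` and `Conjectures.ClusteringFloor d N G ρ β i j a`
(THEORY-2.md §3.1): for `i = j` the "plaquette holonomy" `U(x,i)U(x+eᵢ,i)U(x+eᵢ,i)⁻¹U(x,i)⁻¹` is `1`, the observable
`Re tr ρ(·)` is the constant `N`, and a constant has vanishing connected correlator — whatever the total mass
`m = Z⁻¹·Z ∈ {0,1}` of the Wilson measure is (`N²m − (Nm)² = 0`; no continuity of `ρ` needed).  Hence
`not_crossCutCorrelatorFloor_diag`, `not_clusteringFloor_diag` for ALL `d, N, G, ρ, β, R, a`.  Elementary;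
nothing is cited as a fact.
-/

noncomputable section

namespace Summit.Ventures.LatticeQCDFlow.Theory2.Lattice

open MeasureTheory Literature.MathematicalPhysics.QuantumFieldTheory

section Diag

variable {N : ℕ} {G : Type} [Group G] [TopologicalSpace G] [IsTopologicalGroup G] [CompactSpace G]
  [MeasurableSpace G] [BorelSpace G] (ρ : G →* Matrix (Fin N) (Fin N) ℂ)

omit [TopologicalSpace G] [IsTopologicalGroup G] [CompactSpace G] [MeasurableSpace G] [BorelSpace G] in
/-- A degenerate "plaquette" in the plane `(i, i)` has trivial holonomy. [folklore] -/
theorem plaquetteHolonomy_diag {d L : ℕ} (U : GaugeConfig d L G) (x : Site d L) (i : Fin d) :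
    plaquetteHolonomy U x i i = 1 := by
  unfold plaquetteHolonomy
  rw [mul_inv_cancel_right, mul_inv_cancel]

omit [TopologicalSpace G] [IsTopologicalGroup G] [CompactSpace G] [MeasurableSpace G] [BorelSpace G] in
/-- Hence the diagonal-plane observable is the constant `N`. [folklore] -/
theorem re_trace_plaquetteHolonomy_diag {d L : ℕ} (U : GaugeConfig d L G) (x : Site d L) (i : Fin d) :
    (ρ (plaquetteHolonomy U x i i)).trace.re = N := by
  rw [plaquetteHolonomy_diag, map_one, Matrix.trace_one, Fintype.card_fin]
  simp

/-- The total mass of the Wilson measure is `0` or `1` (it is `Z⁻¹·Z`). [folklore] -/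
theorem wilsonMeasure_univ_toReal {d L : ℕ} [NeZero L] (β : ℝ) :
    ((wilsonMeasure (d := d) (L := L) ρ β) Set.univ).toReal = 0 ∨
      ((wilsonMeasure (d := d) (L := L) ρ β) Set.univ).toReal = 1 := by
  have h : (wilsonMeasure (d := d) (L := L) ρ β) Set.univ =
      (partitionFunction (d := d) (L := L) ρ β)⁻¹ * partitionFunction (d := d) (L := L) ρ β := by
    unfold wilsonMeasure partitionFunction
    rw [Measure.smul_apply, smul_eq_mul]
  rw [h]
  by_cases h0 : partitionFunction (d := d) (L := L) ρ β = 0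
  · left; rw [h0, mul_zero, ENNReal.toReal_zero]
  by_cases htop : partitionFunction (d := d) (L := L) ρ β = ⊤
  · left; rw [htop, ENNReal.inv_top, zero_mul, ENNReal.toReal_zero]
  · right; rw [ENNReal.inv_mul_cancel h0 htop, ENNReal.toReal_one]

/-- A constant observable has vanishing connected correlator under the Wilson measure. [folklore] -/
theorem wilsonExpectation_const_conn {d L : ℕ} [NeZero L] (β c : ℝ) :
    wilsonExpectation (d := d) (L := L) ρ β (fun _ => c * c) -
      wilsonExpectation (d := d) (L := L) ρ β (fun _ => c) *
        wilsonExpectation (d := d) (L := L) ρ β (fun _ => c) = 0 := by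
  unfold wilsonExpectation
  rw [integral_const, integral_const, smul_eq_mul, smul_eq_mul]
  rcases wilsonMeasure_univ_toReal ρ (d := d) (L := L) β with h | h
  · simp [measureReal_def, h]
  · simp [measureReal_def, h]

/-- **The cross-cut correlator floor fails in a diagonal plane `i = j`** (every `d, N, G, ρ, β, R, a`). [folklore] -/
theorem not_crossCutCorrelatorFloor_diag {d : ℕ} (β : ℝ) (R : ℕ) (i a : Fin d) :
    ¬ Conjectures.CrossCutCorrelatorFloor d N G ρ β R i i a := by
  rintro ⟨δ, hδ, L₀, h⟩
  haveI : NeZero (max L₀ 1) := ⟨by omega⟩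
  have h1 := h (max L₀ 1) (le_max_left _ _) (fun _ => 0)
  simp only [re_trace_plaquetteHolonomy_diag] at h1
  rw [wilsonExpectation_const_conn, abs_zero] at h1
  linarith

/-- **The clustering floor fails in a diagonal plane `i = j`** (every `d, N, G, ρ, β, a`). [folklore] -/
theorem not_clusteringFloor_diag {d : ℕ} (β : ℝ) (i a : Fin d) :
    ¬ Conjectures.ClusteringFloor d N G ρ β i i a := by
  rintro ⟨κ₀, hκ₀, ξ, hξ, L₀, h⟩
  haveI : NeZero (max L₀ 1) := ⟨by omega⟩
  have h1 := h (max L₀ 1) (le_max_left _ _) 0 (by omega) (fun _ => 0)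
  simp only [re_trace_plaquetteHolonomy_diag] at h1
  rw [wilsonExpectation_const_conn, abs_zero, Nat.cast_zero, zero_div, neg_zero, Real.exp_zero, mul_one] at h1
  linarith

end Diag

end Summit.Ventures.LatticeQCDFlow.Theory2.Lattice

end
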